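import Summits.BirchSwinnertonDyer.Rank1Residual.P2.RankZeroSpecAtTwo
import HarnessLib

/-!
# Sub-lane «bsd-p2»: the SPEC of a rank-ONE pair in `ℚ`-currency —
# `BSD(E,2) ⟺ ord₂(L′(E,1)/(Ω_E·Reg E)) = ord₂ #Ш(E) + ord₂ ∏c_ℓ − 2·ord₂ #E(ℚ)_tor`, and the
# door shape D-CN-5: `Ш(E)[2^∞] = 0`, `#E(ℚ)_tor = 4` ⇒ `BSD(E,2) ⟺ ord₂(L′/(Ω R)) = ord₂ ∏c_ℓ − 4`

HONEST FRAMING (sub-lane «bsd-p2», run/shared/lean/b2b/bsd-rank1-residual/p2/, verbatim in every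
file): the target of record is the FULL Birch–Swinnerton-Dyer formula for EVERY analytic-rank `≤ 1`
`E/ℚ` at ALL primes INCLUDING `2`; the odd-prime class ledger is referee A's; the `2`-part is OPEN
(cells O1 = X5 ∖ CM and O12 = the CM corner) and under census by «bsd-p2». Census / instrument
output at `2` = EVIDENCE / conjecture items with held-out validation, NEVER a Literature fact;
certificates close PAIRS (one isogeny class, `p = 2`), never classes. This file asserts NO
arithmetic fact: binder Gross–Zagier–Kolyvagin over `ℚ` (`rank_eq_analyticRank_of_analyticRank_le_one`,
for `rank = 1` and the finiteness of `Ш`); `L′(E,1) ≠ 0` is `ord_{s=1} = 1` itself, no modularity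
binder needed.
It is the rank-ONE twin of `P2/RankZeroSpecAtTwo.lean` in `ℚ`-CURRENCY (the regulator `Reg E` as a
datum: `L′(E,1) = x·Ω_E·Reg(E)`, `x ∈ ℚ` — e.g. read off the exact Gross–Zagier index identity of
`P2/HeegnerIndexAtTwo.lean`, or printed for a family), and the SHAPE of door D-CN-5 (p2-lead L2-14:
lit-2's Monsky 1990 Cor 5.15 family — rank `1`, `Ш(E_N)[2^∞] = 0`, `E_N(ℚ)_tor ≅ (ℤ/2)²` — will be
consumed here as `BSD(E_N,2) ⟺ v₂(L′(E_N,1)/(Ω R)) = v₂(∏c_ℓ) − 4`, a biconditional with NO unknown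
`Ш` term). Instantiate on GLOBALLY MINIMAL models only (`shaAn_smul`: `#Ш_an` moves by `|u|`).
A per-pair statement; it closes no class. Nothing booked; no mark moved. Unit `b2b-bsdres-p2-typer`
GEN 3 (p2-lead L2-14); NEW file.

References: Miller, LMS J. Comput. Math. 14 (2011) Def 1.1 [Miller2011LMS]; Monsky, Math. Z. 204
(1990) Cor 5.15 (the family the door is cut for; lit-2's file pending) [Monsky1990MockHeegner]; HOME/p2/LEAD-OKS.md L2-14.
-/

noncomputable section

open scoped Classical

open WeierstrassCurve Literature.NumberTheory.EllipticCurves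
  Literature.NumberTheory.EllipticCurves.Rank1Residual
  Literature.NumberTheory.EllipticCurves.Rank1Residual.Typed

set_option autoImplicit false

namespace Summit.BirchSwinnertonDyer.Rank1Residual.P2

variable (W : WeierstrassCurve ℚ) [W.IsElliptic]

/-- **SPEC OF A RANK-ONE PAIR IN `ℚ`-CURRENCY.** For an elliptic `W/ℚ` (read on the GLOBALLY MINIMAL
model) of analytic rank `1` with `L′(E,1) = x · Ω_E · Reg(E)` (`x ∈ ℚ`; `Ω_E = realPeriodRat`, all
real components; `Reg` = the tree's regulator, canonical height over `ℚ`), granted GZK (`rank = 1`,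
`Ш` finite; `x ≠ 0` because the zero is simple): `Ш(E)` is finite, `#Ш_an(E) = x·#E(ℚ)_tor²/∏c_ℓ`, and
`BSD(E,2) ⟺ ord₂ x = ord₂ #Ш(E) + ord₂ ∏c_ℓ(E) − 2·ord₂ #E(ℚ)_tor`. (The rank-one twin of
`bsdp_two_iff_of_LoverOmega`; `x` is what `P2/HeegnerIndexAtTwo.lean` makes exact from a Heegner
point.) [cite: Miller2011LMS, Def. 1.1 (arXiv:1010.2431 p. 3)] -/
theorem bsdp_two_iff_of_LDerivOverOmegaReg (hGZK : rank_eq_analyticRank_of_analyticRank_le_one)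
    (hr : W.analyticRank = 1) {x : ℚ}
    (hx : deriv W.entireLFunction 1 = (x : ℂ) * (W.realPeriodRat : ℂ) * (W.regulator : ℂ)) :
    Finite W.sha ∧ shaAn W = ((x * (W.torsionOrder : ℚ) ^ 2 / (W.tamagawaProduct : ℚ) : ℚ) : ℂ) ∧
      (BSDp W 2 ↔ padicValRat 2 x = (padicValNat 2 (Nat.card W.sha) : ℤ) +
        padicValNat 2 W.tamagawaProduct - 2 * padicValNat 2 W.torsionOrder) := by
  haveI : Fact (2 : ℕ).Prime := ⟨Nat.prime_two⟩
  obtain ⟨hrank, hfin⟩ := hGZK W (le_of_eq hr)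
  haveI := hfin
  obtain ⟨hlead, hderiv⟩ := leadingLCoeff_eq_deriv_of_analyticRank_eq_one hr
  have hL : W.leadingLCoeff = (x : ℂ) * (W.realPeriodRat : ℂ) * (W.regulator : ℂ) := by
    rw [hlead, hx]
  have hx0 : x ≠ 0 := by
    rintro rfl
    exact hderiv (by rw [hx]; simp)
  exact ⟨hfin, shaAn_eq_of_leadingLCoeff W hL, bsdp_iff_valuation_of_leadingLCoeff W 2 hrank hx0 hL⟩

/-- **THE SHAPE OF DOOR D-CN-5 (p2-lead L2-14).** If moreover the `2`-descent data of the pair are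
known EXACTLY — `Ш(E)[2^∞] = 0` and `#E(ℚ)_tor = 4` (Monsky 1990 Cor 5.15's family: rank `1`,
`Ш[2^∞] = 0`, torsion `(ℤ/2)²`) — then `BSD(E,2) ⟺ ord₂(L′(E,1)/(Ω_E·Reg E)) = ord₂ ∏c_ℓ(E) − 4`:
a biconditional with no unknown `Ш` term (`ord₂ #Ш = 0` by `padicValNat_card_addPrimaryComponent`,
`2·ord₂ 4 = 4`). Binder: GZK. The family fact itself is lit-2's (pending); this is the
consumer's shape, stated for any globally minimal `W` with these data. [cite: Miller2011LMS, Def. 1.1]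
[cite: Monsky1990MockHeegner, Cor. 5.15] -/
theorem bsdp_two_iff_of_LDerivOverOmegaReg_of_sha_two_eq_bot_of_torsionOrder_eq_four
    (hGZK : rank_eq_analyticRank_of_analyticRank_le_one) (hr : W.analyticRank = 1) {x : ℚ}
    (hx : deriv W.entireLFunction 1 = (x : ℂ) * (W.realPeriodRat : ℂ) * (W.regulator : ℂ))
    (hsha : AddCommGroup.primaryComponent W.sha 2 = ⊥) (ht : W.torsionOrder = 4) :
    BSDp W 2 ↔ padicValRat 2 x = (padicValNat 2 W.tamagawaProduct : ℤ) - 4 := by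
  haveI : Fact (2 : ℕ).Prime := ⟨Nat.prime_two⟩
  obtain ⟨hfin, -, hiff⟩ := bsdp_two_iff_of_LDerivOverOmegaReg W hGZK hr hx
  haveI := hfin
  have hsha0 : padicValNat 2 (Nat.card W.sha) = 0 := by
    rw [← padicValNat_card_addPrimaryComponent 2 (A := W.sha), hsha]
    simp
  have ht4 : padicValNat 2 W.torsionOrder = 2 := by
    rw [ht, show (4 : ℕ) = 2 ^ 2 by norm_num, padicValNat.prime_pow]
  rw [hiff, hsha0, ht4]
  push_cast
  omega

end Summit.BirchSwinnertonDyer.Rank1Residual.P2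

end
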